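import Summits.QuantumFields.YangMills.Theorems.IR.ColdDefectFreezingLimit
import Summits.QuantumFields.YangMills.Theorems.IR.FlatConnectionCount
import Literature.LinearAlgebra.Matrix.TraceSingularValueInequality
import HarnessLib

/-!
# THE NUMBER's currency at a finite ABELIAN gauge group: `coldDefect ρ β L → 1 − |G|⁻³` at every box (helper for stmt-QuantumFields-26930)

Conclusion of the helper triple `ColdDefectFreezingLimit` (p783777: freezing `Z_β → Haar(Flat)`, `δᶜ_β(L) → 1 − Haar(Flat₂)/Haar(Flat₁)²`),
`FlatConnectionPropagation` (p784028) and `FlatConnectionCount` (`card_flat`: `#Flat = |G|^{V+3}` for finite abelian `G`); LEAD prover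
`ymfull-r2c-lead-1` g0, cell `ym-gapexp`, `--supports stmt-QuantumFields-26930` (director-ym R590 item (8): BC5 ∕ toy-rung side).

* `tendsto_coldDefect_atTop_finite_abelian` — for a FINITE ABELIAN gauge group `G` (discrete), every matrix representation `ρ` whose character
  detects the identity (`Re tr ρ(g) = n ↔ g = 1`, e.g. any faithful unitary `ρ`: `re_trace_eq_iff_eq_one`) and every `L ≥ 4`:
  **`coldDefect ρ β L → 1 − |G|⁻³` as `β → ∞`** — at EVERY box.  (`Haar(Flat(L³×T)) = |G|^{V+3−4V}` with `V = L³T`, and `V` doubles with `T`.)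
* `eventually_lt_coldDefect_finite_abelian`, `eventually_one_div_24_lt_coldDefect` — hence for nontrivial `G` the fixed-box purity test of
  THE NUMBER (`coldDefect ≤ 1/24`, indeed any tolerance `< 1 − |G|⁻³ ≥ 7/8`) FAILS at every box `L ≥ 4` for all large `β`;
  `eventually_one_div_24_lt_coldDefect_z2` — the concrete instance `ℤ₂` (`z2Rep`): `δᶜ_β(L) > 1/24` eventually, limit `7/8`.

READING (BC5 side of the crux `IRcof`, kernel form of the card's sentence «at `π₁(G) ≠ 1`, `δᶜ → 1 − |π₁|⁻³`» in its finite-group extreme):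
the purity currency of the registered stub `stub_pinnedExitsCofinal` sees the `|G|³`-fold degeneracy of 't Hooft flux vacua and is therefore
bounded AWAY from purity at every fixed box for every finite abelian group, although finite gauge groups DO cluster exponentially at weak coupling
(Adhikari–Cao 2022, free b.c. — in the tree by name only, `AdhikariCao2022.CorrelationDecay`): the stub is strictly stronger than local
clustering wherever flux sectors are degenerate; for the route's groups (compact simple, `π₁ = 1`) the flat set is Haar-null and the fixed-box
limit is the `0/0` competition this calibration does not decide.  HONEST FRAMING: finite-volume calibration; nothing here proves
`PinnedExitsCofinalAt`, `IRcof`, `IR`, or the Yang–Mills mass gap (Clay); R4 closes only the conditional finite-𝕋⁴ rung `BalabanLadder.UV`.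
Def-free.  Reference: G. 't Hooft, Nucl. Phys. B153 (1979) 141 (flux sectors); Horn–Johnson Thm 7.4.1.4 (tree `re_trace_eq_card_iff_of_mem_unitaryGroup`).
-/

set_option autoImplicit false

noncomputable section

open Filter Topology MeasureTheory
open Literature.MathematicalPhysics.QuantumFieldTheory Literature.MathematicalPhysics.QuantumLattice
open Summit.QuantumFields.YangMills.Cruxes.IR.ColdPurityBridge (coldDefect)

namespace Summit.QuantumFields.YangMills.Cruxes.IR.FreezingLimit

/-! ## §1 Characters detecting the identity -/

/-- A faithful representation with unitary values detects the identity by its character: `Re tr ρ(g) = n ↔ g = 1`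
(Horn–Johnson 7.4.1.4 equality case, tree `re_trace_eq_card_iff_of_mem_unitaryGroup`). -/
theorem re_trace_eq_iff_eq_one {G : Type} [Group G] {n : ℕ} (ρ : G →* Matrix (Fin n) (Fin n) ℂ)
    (hρu : ∀ g, ρ g ∈ Matrix.unitaryGroup (Fin n) ℂ) (hρi : Function.Injective ρ) (g : G) :
    (ρ g).trace.re = n ↔ g = 1 := by
  have h := Literature.LinearAlgebra.Matrix.re_trace_eq_card_iff_of_mem_unitaryGroup (hρu g)
  simp only [Fintype.card_fin, RCLike.re_to_complex] at h
  rw [h, ← map_one ρ]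
  exact hρi.eq_iff

/-- The character of a lattice representation (`LatticeRep`: faithful, unitary) detects the identity. -/
theorem re_trace_eq_iff_eq_one_latticeRep {G : Type} [Group G] [TopologicalSpace G] (r : LatticeRep G) (g : G) :
    (r.ρ g).trace.re = r.N ↔ g = 1 :=
  re_trace_eq_iff_eq_one r.ρ r.mem_unitary r.injective g

/-! ## §2 The flat mass of a finite abelian gauge group -/

section FiniteAbelian

variable {G : Type} [CommGroup G] [Fintype G] [TopologicalSpace G] [DiscreteTopology G] [IsTopologicalGroup G]
  [CompactSpace G] [MeasurableSpace G] [BorelSpace G]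
variable {n : ℕ} (ρ : G →* Matrix (Fin n) (Fin n) ℂ) (hρ : ∀ g, (ρ g).trace.re = n ↔ g = 1)
include hρ

omit [Fintype G] [TopologicalSpace G] [DiscreteTopology G] [IsTopologicalGroup G] [CompactSpace G] [MeasurableSpace G]
  [BorelSpace G] in
/-- With an identity-detecting character, the character-flat set is the set of fields with trivial plaquette holonomies. -/
theorem charFlat_iff_flat {n₀ n₁ n₂ n₃ : ℕ} (U : FinTorusSite n₀ n₁ n₂ n₃ × Fin 4 → G) :
    (∀ (x : FinTorusSite n₀ n₁ n₂ n₃) (q : {q : Fin 4 × Fin 4 // q.1 < q.2}), (ρ (finTorusPlaquette U x q.1.1 q.1.2)).trace.re = n) ↔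
      ∀ x μ ν, finTorusPlaquette U x μ ν = 1 := by
  rw [flat_iff_flat_lt]
  exact forall_congr' fun x => forall_congr' fun q => hρ _

omit [TopologicalSpace G] [DiscreteTopology G] [IsTopologicalGroup G] [CompactSpace G] [MeasurableSpace G] [BorelSpace G] in
/-- **Count of the character-flat set**: `|G|^{V+3}` (`card_flat`). -/
theorem card_charFlat {n₀ n₁ n₂ n₃ : ℕ} (h₀ : 0 < n₀) (h₁ : 0 < n₁) (h₂ : 0 < n₂) (h₃ : 0 < n₃) :
    Nat.card {U : FinTorusSite n₀ n₁ n₂ n₃ × Fin 4 → G |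
      ∀ (x : FinTorusSite n₀ n₁ n₂ n₃) (q : {q : Fin 4 × Fin 4 // q.1 < q.2}),
        (ρ (finTorusPlaquette U x q.1.1 q.1.2)).trace.re = n} =
      Fintype.card G ^ (Fintype.card (FinTorusSite n₀ n₁ n₂ n₃) + 3) := by
  rw [← Nat.card_eq_fintype_card, ← Nat.card_eq_fintype_card, ← card_flat (G := G) h₀ h₁ h₂ h₃]
  exact Nat.card_congr (Equiv.subtypeEquivRight fun U => charFlat_iff_flat ρ hρ U)

/-- **Flat mass of a finite abelian gauge group**: `Haar(Flat(n₀×n₁×n₂×n₃)) = |G|^{V+3} / |G|^{4V}`. -/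
theorem measureReal_charFlat {n₀ n₁ n₂ n₃ : ℕ} (h₀ : 0 < n₀) (h₁ : 0 < n₁) (h₂ : 0 < n₂) (h₃ : 0 < n₃) :
    (Measure.pi fun _ : FinTorusSite n₀ n₁ n₂ n₃ × Fin 4 => haarProbability G).real
        {U : FinTorusSite n₀ n₁ n₂ n₃ × Fin 4 → G |
          ∀ (x : FinTorusSite n₀ n₁ n₂ n₃) (q : {q : Fin 4 × Fin 4 // q.1 < q.2}),
            (ρ (finTorusPlaquette U x q.1.1 q.1.2)).trace.re = n} =
      (Fintype.card G : ℝ) ^ (Fintype.card (FinTorusSite n₀ n₁ n₂ n₃) + 3) /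
        (Fintype.card G : ℝ) ^ Fintype.card (FinTorusSite n₀ n₁ n₂ n₃ × Fin 4) := by
  rw [measureReal_pi_haarProbability_eq_card, card_charFlat ρ hρ h₀ h₁ h₂ h₃]
  push_cast
  ring

/-! ## §3 The freezing limit of THE NUMBER's currency at a finite abelian gauge group -/

/-- **`coldDefect ρ β L → 1 − |G|⁻³`** as `β → ∞`, for a finite abelian (discrete) gauge group, an identity-detecting character and every `L ≥ 4`. -/
theorem tendsto_coldDefect_atTop_finite_abelian {L : ℕ} (hL : 4 ≤ L) :
    Tendsto (fun β : ℝ => coldDefect ρ β L) atTop (𝓝 (1 - ((Fintype.card G : ℝ) ^ 3)⁻¹)) := by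
  have hL0 : 0 < L := by omega
  have hT : 0 < L / 4 := Nat.div_pos hL (by norm_num)
  have hT2 : 0 < 2 * (L / 4) := by omega
  have hlim := tendsto_coldDefect_atTop_of_finite ρ L
  rw [measureReal_charFlat ρ hρ hL0 hL0 hL0 hT2, measureReal_charFlat ρ hρ hL0 hL0 hL0 hT] at hlim
  simp only [Fintype.card_prod, Fintype.card_fin] at hlim
  have hV : L * (L * (L * (2 * (L / 4)))) = 2 * (L * (L * (L * (L / 4)))) := by ring
  rw [hV] at hlim
  have hq : (0 : ℝ) < Fintype.card G := by exact_mod_cast Fintype.card_pos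
  convert hlim using 2
  set V : ℕ := L * (L * (L * (L / 4))) with hVdef
  set q : ℝ := (Fintype.card G : ℝ) with hqdef
  field_simp
  ring

/-- **The fixed-box purity test fails at a finite abelian gauge group**: for every tolerance `θ < 1 − |G|⁻³` and every `L ≥ 4`,
`θ < coldDefect ρ β L` for all sufficiently large `β`. -/
theorem eventually_lt_coldDefect_finite_abelian {L : ℕ} (hL : 4 ≤ L) {θ : ℝ} (hθ : θ < 1 - ((Fintype.card G : ℝ) ^ 3)⁻¹) :
    ∀ᶠ β : ℝ in atTop, θ < coldDefect ρ β L :=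
  (tendsto_coldDefect_atTop_finite_abelian ρ hρ hL).eventually (eventually_gt_nhds hθ)

/-- **In particular at THE NUMBER's tolerance `1/24`**: for a NONTRIVIAL finite abelian gauge group (`|G| ≥ 2`, so `1 − |G|⁻³ ≥ 7/8`) and
every `L ≥ 4`, the cold box `L³ × ⌊L/4⌋` is NOT `1/24`-pure for all sufficiently large `β`. -/
theorem eventually_one_div_24_lt_coldDefect [Nontrivial G] {L : ℕ} (hL : 4 ≤ L) :
    ∀ᶠ β : ℝ in atTop, (1 : ℝ) / 24 < coldDefect ρ β L := by
  refine eventually_lt_coldDefect_finite_abelian ρ hρ hL ?_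
  have h2 : (2 : ℝ) ≤ Fintype.card G := by exact_mod_cast Fintype.one_lt_card
  have h8 : (8 : ℝ) ≤ (Fintype.card G : ℝ) ^ 3 := by
    have := pow_le_pow_left₀ (by norm_num) h2 3
    norm_num at this
    exact this
  have hinv : ((Fintype.card G : ℝ) ^ 3)⁻¹ ≤ 1 / 8 := by
    rw [one_div]; exact inv_anti₀ (by norm_num) h8
  linarith

end FiniteAbelian

/-! ## §4 The concrete instance `ℤ₂` -/

/-- The sign character of `ℤ₂` detects the identity: `Re tr z2Rep(a) = 1 ↔ a = 1`. -/
theorem re_trace_z2Rep_eq_iff (a : Multiplicative (ZMod 2)) : (z2Rep a).trace.re = (1 : ℕ) ↔ a = 1 := by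
  have hval : a.toAdd.val = 0 ∨ a.toAdd.val = 1 := by
    have := ZMod.val_lt (Multiplicative.toAdd a); omega
  rcases hval with h | h
  · have ha : a = 1 := by
      have : Multiplicative.toAdd a = 0 := (ZMod.val_eq_zero _).1 h
      simpa using congrArg Multiplicative.ofAdd this
    subst ha
    simp [Matrix.trace_one]
  · have ha : a ≠ 1 := by
      intro ha; subst ha; simp at h
    simp only [z2Rep_apply, h, pow_one, Matrix.trace_smul, Matrix.trace_one, Fintype.card_fin, Nat.cast_one,
      smul_eq_mul, mul_one, Complex.neg_re, Complex.one_re, ha, iff_false]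
    norm_num

/-- **ℤ₂ lattice gauge theory: THE NUMBER's currency freezes at `7/8`** — `coldDefect z2Rep β L → 1 − 2⁻³` as `β → ∞`, every `L ≥ 4`. -/
theorem tendsto_coldDefect_atTop_z2 {L : ℕ} (hL : 4 ≤ L) :
    Tendsto (fun β : ℝ => coldDefect z2Rep β L) atTop (𝓝 (1 - ((2 : ℝ) ^ 3)⁻¹)) := by
  have h := tendsto_coldDefect_atTop_finite_abelian z2Rep re_trace_z2Rep_eq_iff hL
  have hcard : (Fintype.card (Multiplicative (ZMod 2)) : ℝ) = 2 := by simp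
  rwa [hcard] at h

/-- **ℤ₂: the cold box is never `1/24`-pure at large `β`** (`coldDefect z2Rep β L > 1/24` eventually, every `L ≥ 4`). -/
theorem eventually_one_div_24_lt_coldDefect_z2 {L : ℕ} (hL : 4 ≤ L) :
    ∀ᶠ β : ℝ in atTop, (1 : ℝ) / 24 < coldDefect z2Rep β L :=
  eventually_one_div_24_lt_coldDefect z2Rep re_trace_z2Rep_eq_iff hL

end Summit.QuantumFields.YangMills.Cruxes.IR.FreezingLimit

end
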